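import Summits.HubbardSuperconductivity.HubbardSuperconductivity.Theses.BalabanIR
import Summits.HubbardSuperconductivity.HubbardSuperconductivity.Theorems.BalabanIRBirGappedPhaseReductionStructural

/-!
# Route BalabanIR — crux 4R `BirGappedPhaseReductionR` (item `stmt-HubbardSuperconductivity-14846`): logical status and delivery forms

`BirGappedPhaseReductionR := BirComplexStableXYR → BirBdGPhaseCoercivity → BirGroundStateAverageLRO`
(restated engine → static BdG phase coercivity → target, route rev 6–8).

This is a `--supports` module (it names the route's declarations and therefore imports the Theses
file; by the route's materialisation rule no CLOSING module may import it).  It records, kernel-checked: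

* the three one-line closers of the item as typed — from the target (`…_of_target`), from the
  negation of the restated engine (`…_of_not_engineR`), from the negation of the coercivity crux
  (`…_of_not_bdgCoercivity`);
* `not_birGappedPhaseReductionR_iff` : `¬ 4R ↔ 2R ∧ 3 ∧ ¬ target` — the item is refutable only by
  proving BOTH antecedents and refuting the target; and `birGappedPhaseReductionR_iff_target` :
  under the route's own hypotheses `h2R`, `h3` the item is EQUIVALENT to the target (as typed it is
  dominated by item `stmt-HubbardSuperconductivity-2079`);
* `birComplexStableXYR_of_birComplexStableXY` : the rev-0 engine implies the restated one (the
  restatement only ADDS the hypotheses (R), (P), `Even L`, `Even M`), hence every refutation of the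
  restated engine refutes the rev-0 engine (`not_birComplexStableXY_of_not_engineR`) and the restated
  reduction together with crux 3 gives back the rev-0 reduction
  (`birGappedPhaseReduction_of_reductionR`);
* the THERMAL delivery forms of the item (`birGappedPhaseReductionR_of_frequently_thermal`,
  `…_of_eventually_thermal`): what the constructive half has to produce on the Hubbard side from
  `h2R`, `h3` is a frequent- (or eventual-) in-`β` lower bound `c L⁴` on the canonical
  `(N_L, S^z = 0)`-sector Gibbs average of `Δ_d† Δ_d`; the `β → ∞` endgame is the Theses-free bridge
  `dWaveGroundStateAverageLRO_of_frequently_thermal` of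
  `Theorems/BalabanIRBirGappedPhaseReductionStructural.lean`.

Pure logic over the route's definitions; H. Tasaki, *Physics and Mathematics of Quantum Many-Body
Systems* (2020), App. A for the thermal endgame (already landed).  Folklore; no definition is
introduced.
-/

noncomputable section

namespace Summit.HubbardSuperconductivity.HubbardSuperconductivity.Theorems

open Filter Matrix Literature.MathematicalPhysics.QuantumLattice Literature.Probability.LatticeModels
open Summit.HubbardSuperconductivity.HubbardSuperconductivity.Theses.BalabanIR

/-! ### Logical status of the item as typed -/

/-- The target `BirGroundStateAverageLRO` closes the reduction `BirGappedPhaseReductionR`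
outright (the antecedents are discarded). [folklore] -/
theorem birGappedPhaseReductionR_of_target (h : BirGroundStateAverageLRO) :
    BirGappedPhaseReductionR :=
  fun _ _ => h

/-- The reduction `BirGappedPhaseReductionR` follows (vacuously) from the negation of the restated
engine `BirComplexStableXYR`; this is the closing term of item 14846 if item 14845 is refuted as
typed. [folklore] -/
theorem birGappedPhaseReductionR_of_not_engineR (h : ¬ BirComplexStableXYR) :
    BirGappedPhaseReductionR :=
  fun hE => absurd hE h

/-- The reduction `BirGappedPhaseReductionR` follows (vacuously) from the negation of the static
BdG phase-coercivity crux `BirBdGPhaseCoercivity`; this is the closing term of item 14846 if item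
2081 is refuted as typed. [folklore] -/
theorem birGappedPhaseReductionR_of_not_bdgCoercivity (h : ¬ BirBdGPhaseCoercivity) :
    BirGappedPhaseReductionR :=
  fun _ hC => absurd hC h

/-- `¬ BirGappedPhaseReductionR ↔ BirComplexStableXYR ∧ BirBdGPhaseCoercivity ∧ ¬ BirGroundStateAverageLRO`:
the item is refutable only by proving BOTH antecedents AND refuting the target. [folklore] -/
theorem not_birGappedPhaseReductionR_iff :
    ¬ BirGappedPhaseReductionR ↔
      (BirComplexStableXYR ∧ BirBdGPhaseCoercivity ∧ ¬ BirGroundStateAverageLRO) := by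
  unfold BirGappedPhaseReductionR
  rw [Classical.not_imp, Classical.not_imp]

/-- Under the route's own hypotheses (the restated engine and the coercivity crux) the reduction is
EQUIVALENT to the target: as typed, item 14846 is dominated by item 2079. [folklore] -/
theorem birGappedPhaseReductionR_iff_target (h2R : BirComplexStableXYR) (h3 : BirBdGPhaseCoercivity) :
    BirGappedPhaseReductionR ↔ BirGroundStateAverageLRO :=
  ⟨fun h => h h2R h3, fun h _ _ => h⟩

/-! ### The restatement only adds hypotheses -/

/-- **The rev-0 engine implies the restated engine.** `BirComplexStableXYR` is `BirComplexStableXY`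
with the extra hypotheses (R) time-reflection Hermiticity, (P) inversion evenness, `Even L` and
`Even M` inserted and nothing else changed, so the old statement implies the new one by discarding
them. Consequently every witness against the restated engine is a witness against the rev-0
engine, not conversely. [folklore] -/
theorem birComplexStableXYR_of_birComplexStableXY (h : BirComplexStableXY) :
    BirComplexStableXYR := by
  intro r B c₀ hr hc₀
  obtain ⟨K₀, L₀, hK⟩ := h r B c₀ hr hc₀
  refine ⟨K₀, L₀, fun K hKK c hU hN hA hC _ _ L M _ _ hL hLM _ _ => ?_⟩
  exact hK K hKK c hU hN hA hC L M hL hLM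

/-- A refutation of the restated engine refutes the rev-0 engine (contrapositive of
`birComplexStableXYR_of_birComplexStableXY`). [folklore] -/
theorem not_birComplexStableXY_of_not_engineR (h : ¬ BirComplexStableXYR) :
    ¬ BirComplexStableXY :=
  fun hE => h (birComplexStableXYR_of_birComplexStableXY hE)

/-- The restated reduction together with the coercivity crux gives back the rev-0 reduction
`BirGappedPhaseReduction := BirComplexStableXY → BirGroundStateAverageLRO`. [folklore] -/
theorem birGappedPhaseReduction_of_reductionR (h4R : BirGappedPhaseReductionR)
    (h3 : BirBdGPhaseCoercivity) : BirGappedPhaseReduction :=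
  fun hE => h4R (birComplexStableXYR_of_birComplexStableXY hE) h3

/-! ### Thermal delivery forms of the item -/

/-- **The reduction in FREQUENT thermal form implies the item.** If the restated engine and the
BdG phase coercivity yield, for some `δ ∈ (0,1/2)`, an open window of couplings and `c > 0`,
eventually in even `L`, the bound `c L⁴ ≤` canonical `(2⌊(1-δ)L²/2⌋, S^z = 0)`-sector Gibbs average
of `Δ_d† Δ_d` for `hubbardTorus 2 L 1 U` on an UNBOUNDED set of inverse temperatures `β` (the natural
output of a `(2+1)`-dimensional functional integral along `M = β/a → ∞`), then
`BirGappedPhaseReductionR` holds; the `β → ∞` endgame is the Theses-free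
`dWaveGroundStateAverageLRO_of_frequently_thermal`. Tasaki (2020) App. A. [folklore] -/
theorem birGappedPhaseReductionR_of_frequently_thermal
    (h : BirComplexStableXYR → BirBdGPhaseCoercivity →
      ∃ δ ∈ Set.Ioo (0:ℝ) (1/2), ∃ U₁ U₂ c : ℝ, 0 < U₁ ∧ U₁ < U₂ ∧ 0 < c ∧
      ∀ U ∈ Set.Ioo U₁ U₂, ∃ L₀ : ℕ, ∀ (L : ℕ) [NeZero L], L₀ ≤ L → Even L →
        let N : ℕ := 2 * ⌊(1 - δ) * (L : ℝ) ^ 2 / 2⌋₊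
        let H := hubbardTorus 2 L 1 U
        let S := szSector (Λ := FermionTorus 2 L) N 0
        let PS := projMatrix (S.map (Fock.toEuclidean (ι := Orb (FermionTorus 2 L)) :
          Fock (Orb (FermionTorus 2 L)) →ₗ[ℂ] EuclideanSpace ℂ (Finset (Orb (FermionTorus 2 L)))))
        ∃ᶠ β : ℝ in atTop, c * (L : ℝ) ^ 4 ≤
          ((PS * gibbsWeight β H *
              ((pairField dWaveFormFactor L)ᴴ * pairField dWaveFormFactor L)).trace /
            (PS * gibbsWeight β H).trace).re) :
    BirGappedPhaseReductionR :=
  fun h2R h3 => dWaveGroundStateAverageLRO_of_frequently_thermal (h h2R h3)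

/-- **The reduction in EVENTUAL thermal form implies the item**: as
`birGappedPhaseReductionR_of_frequently_thermal` with the sector Gibbs bound for all large `β`.
Tasaki (2020) App. A. [folklore] -/
theorem birGappedPhaseReductionR_of_eventually_thermal
    (h : BirComplexStableXYR → BirBdGPhaseCoercivity →
      ∃ δ ∈ Set.Ioo (0:ℝ) (1/2), ∃ U₁ U₂ c : ℝ, 0 < U₁ ∧ U₁ < U₂ ∧ 0 < c ∧
      ∀ U ∈ Set.Ioo U₁ U₂, ∃ L₀ : ℕ, ∀ (L : ℕ) [NeZero L], L₀ ≤ L → Even L →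
        let N : ℕ := 2 * ⌊(1 - δ) * (L : ℝ) ^ 2 / 2⌋₊
        let H := hubbardTorus 2 L 1 U
        let S := szSector (Λ := FermionTorus 2 L) N 0
        let PS := projMatrix (S.map (Fock.toEuclidean (ι := Orb (FermionTorus 2 L)) :
          Fock (Orb (FermionTorus 2 L)) →ₗ[ℂ] EuclideanSpace ℂ (Finset (Orb (FermionTorus 2 L)))))
        ∀ᶠ β : ℝ in atTop, c * (L : ℝ) ^ 4 ≤
          ((PS * gibbsWeight β H *
              ((pairField dWaveFormFactor L)ᴴ * pairField dWaveFormFactor L)).trace /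
            (PS * gibbsWeight β H).trace).re) :
    BirGappedPhaseReductionR :=
  fun h2R h3 => dWaveGroundStateAverageLRO_of_eventually_thermal (h h2R h3)

/-! ### After the closure of crux 3 (line lead gen 1 attempt 1, 2026-08-16)

Item `stmt-HubbardSuperconductivity-2081` is CLOSED (`BirBdGPhaseCoercivity_holds`, linked into the
route file from `Theorems.BirBdG.birBdGPhaseCoercivity_proof`).  The second antecedent of the item is
therefore discharged once and for all: as typed, the reduction IS the implication
`BirComplexStableXYR → BirGroundStateAverageLRO`, and what any line has to deliver on the Hubbard
side — from the restated engine ALONE — is the frequent-in-`β` canonical-sector thermal bound. -/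

/-- **Crux 3 is discharged.** With `BirBdGPhaseCoercivity` proved (`BirBdGPhaseCoercivity_holds`),
the reduction `BirGappedPhaseReductionR` is EQUIVALENT to the bare implication
`BirComplexStableXYR → BirGroundStateAverageLRO` (restated engine ⇒ target). [folklore] -/
theorem birGappedPhaseReductionR_iff_engineR_imp_target : BirGappedPhaseReductionR ↔ (BirComplexStableXYR → BirGroundStateAverageLRO) :=
  ⟨fun h h2R => h h2R BirBdGPhaseCoercivity_holds, fun h h2R _ => h h2R⟩

/-- **Under the restated engine alone the item is the target.** With crux 3 proved, the single
remaining route hypothesis `h2R : BirComplexStableXYR` makes `BirGappedPhaseReductionR` equivalent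
to `BirGroundStateAverageLRO` (item `stmt-HubbardSuperconductivity-2079`). [folklore] -/
theorem birGappedPhaseReductionR_iff_target_of_engineR (h2R : BirComplexStableXYR) :
    BirGappedPhaseReductionR ↔ BirGroundStateAverageLRO :=
  birGappedPhaseReductionR_iff_target h2R BirBdGPhaseCoercivity_holds

/-- **Residual delivery form (crux 3 discharged).** If the restated engine ALONE yields, for some
`δ ∈ (0,1/2)`, an open window of couplings and `c > 0`, eventually in even `L`, the bound `c L⁴ ≤`
canonical `(2⌊(1-δ)L²/2⌋, S^z = 0)`-sector Gibbs average of `Δ_d† Δ_d` for `hubbardTorus 2 L 1 U`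
frequently in `β`, then `BirGappedPhaseReductionR` holds — the static BdG coercivity is available
inside such a proof as the theorem `BirBdGPhaseCoercivity_holds`, not as a hypothesis.
Tasaki (2020) App. A for the `β → ∞` endgame (Theses-free bridge
`dWaveGroundStateAverageLRO_of_frequently_thermal`). [folklore] -/
theorem birGappedPhaseReductionR_of_engineR_imp_frequently_thermal
    (h : BirComplexStableXYR →
      ∃ δ ∈ Set.Ioo (0:ℝ) (1/2), ∃ U₁ U₂ c : ℝ, 0 < U₁ ∧ U₁ < U₂ ∧ 0 < c ∧
      ∀ U ∈ Set.Ioo U₁ U₂, ∃ L₀ : ℕ, ∀ (L : ℕ) [NeZero L], L₀ ≤ L → Even L →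
        let N : ℕ := 2 * ⌊(1 - δ) * (L : ℝ) ^ 2 / 2⌋₊
        let H := hubbardTorus 2 L 1 U
        let S := szSector (Λ := FermionTorus 2 L) N 0
        let PS := projMatrix (S.map (Fock.toEuclidean (ι := Orb (FermionTorus 2 L)) :
          Fock (Orb (FermionTorus 2 L)) →ₗ[ℂ] EuclideanSpace ℂ (Finset (Orb (FermionTorus 2 L)))))
        ∃ᶠ β : ℝ in atTop, c * (L : ℝ) ^ 4 ≤
          ((PS * gibbsWeight β H *
              ((pairField dWaveFormFactor L)ᴴ * pairField dWaveFormFactor L)).trace /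
            (PS * gibbsWeight β H).trace).re) :
    BirGappedPhaseReductionR :=
  fun h2R _ => dWaveGroundStateAverageLRO_of_frequently_thermal (h h2R)

/-! ### The superseded rev-0 reduction record (item `stmt-HubbardSuperconductivity-2082`) after crux 3

`BirGappedPhaseReduction := BirComplexStableXY → BirGroundStateAverageLRO` (rev-0, superseded support
record).  With crux 3 discharged it is a ONE-HYPOTHESIS corollary of the live crux 4R: the rev-0 engine
implies the restated engine (`birComplexStableXYR_of_birComplexStableXY`), and the coercivity antecedent
is the theorem `BirBdGPhaseCoercivity_holds`.  So item 2082 closes the moment item 14846 closes (the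
closing module must restate the type structurally, see the route's materialisation rule), and — being
glue, `¬ 2082 ↔ BirComplexStableXY ∧ ¬ BirGroundStateAverageLRO`
(`Theorems.not_birGappedPhaseReduction_iff`) — it has no independent proof or refutation short of the
target or of a Theses-free `¬ BirComplexStableXY`. -/

/-- **4R alone gives the rev-0 reduction (crux 3 discharged).** `BirGappedPhaseReductionR →
BirGappedPhaseReduction`: feed the rev-0 engine to the restated one
(`birComplexStableXYR_of_birComplexStableXY`) and the proved coercivity `BirBdGPhaseCoercivity_holds`.
Item `stmt-HubbardSuperconductivity-2082` is therefore dominated by item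
`stmt-HubbardSuperconductivity-14846`. [folklore] -/
theorem birGappedPhaseReduction_of_birGappedPhaseReductionR (h4R : BirGappedPhaseReductionR) :
    BirGappedPhaseReduction :=
  birGappedPhaseReduction_of_reductionR h4R BirBdGPhaseCoercivity_holds

/-- **Status of the rev-0 reduction record as typed (crux 3 discharged).** `BirGappedPhaseReduction`
holds iff the rev-0 engine implies the target; in particular it follows from each of: the target
(`birGappedPhaseReduction_of_thermal`-type closers), the live crux 4R
(`birGappedPhaseReduction_of_birGappedPhaseReductionR`), a refutation of the restated engine
(`not_birComplexStableXY_of_not_engineR` + `birGappedPhaseReduction_of_not_engine`). This disjunction of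
sufficient conditions is recorded here as one implication from their `Or`. [folklore] -/
theorem birGappedPhaseReduction_of_upstream
    (h : BirGappedPhaseReductionR ∨ ¬ BirComplexStableXYR ∨ BirGroundStateAverageLRO) :
    BirGappedPhaseReduction := by
  rcases h with h4R | hnE | hX
  · exact birGappedPhaseReduction_of_birGappedPhaseReductionR h4R
  · exact fun hE => absurd (birComplexStableXYR_of_birComplexStableXY hE) hnE
  · exact fun _ => hX

end Summit.HubbardSuperconductivity.HubbardSuperconductivity.Theorems
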